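import Literature.AlgebraicGeometry.AbelianSchemes.PoincarePullbackStabilizerConstant
import Literature.AlgebraicGeometry.AbelianSchemes.PoincarePullbackTorsion
import Literature.AlgebraicGeometry.AbelianSchemes.AbelianSchemeQuotientDualPairUnique
import HarnessLib

/-!
# (K) for the dual-of-a-quotient: the stabiliser hypothesis `hStab` from the character step alone

The uniqueness half of the universal property of `(Â/K′, 𝒫_B^{rig})` (★ `AbelianSchemeQuotientDualPairUnique`,
[MumfordAV1970] §15 Thm. 1) takes the hypothesis `hStab` («the scheme-theoretic stabiliser of `𝒩₁ = (π × 1)^*𝒫` is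
`K′`»).  ★ `PoincarePullbackStabilizerConstant.stabilizer_le_of_torsion_of_character` assembles `hStab` from a torsion step
`hTors` and a character step `hChar`; ★ `PoincarePullbackTorsion` (B-p05 (g15)) PROVES the torsion step for `𝒩₁` over a
reduced base.  This file plugs the two together: **`hStab` holds as soon as the character step `hChar` does**
(`hStab_of_hChar`) — for `S` reduced and locally Noetherian, `n` invertible on `S`, the unit hypothesis `hD`
(`𝒫|_{A × e} ≅ 𝒪`) and a level-`n` structure `φ̂` on `Â` (★ `PolarizationHatLevelStructure` supplies it in the Siegel
case).  The remaining raw input `hChar` is the (K4)+(K5) brick («a constant section `φ̂(c)` translating some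
`T`-point without changing the class of `𝒩₁` lies in `K′`»).

## References

* [MumfordAV1970] D. Mumford, *Abelian Varieties* (1970), §15 Thm. 1 (p. 143).
* [MilneAV2008] J. S. Milne, *Abelian Varieties* (2008), I §8 (pp. 36–37).
* [MumfordFogartyKirwan1994] D. Mumford, J. Fogarty, F. Kirwan, *GIT* (3rd ed.), Ch. 7 §2 Def. 7.1 (p. 129).
-/

noncomputable section

-- `(A.baseChange f).X = (Over.pullback f).obj A.X` / `(A.X ⊗ B.X).left = A.prodLeft B` hold by `rfl` only.
set_option backward.isDefEq.respectTransparency false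

universe u

open CategoryTheory CategoryTheory.Limits AlgebraicGeometry MonoidalCategory CartesianMonoidalCategory

open scoped MonObj

namespace Literature.AlgebraicGeometry.AbelianSchemes

namespace AbelianSchemeOver

open Literature.AlgebraicGeometry.RelativeSpec

variable {S : Scheme.{u}} (A : AbelianSchemeOver S)
  {Y : Scheme.{u}} (u : S ⟶ Y) (K : Subgroup A.Sections) [IsCommMonObj A.X] {n : ℕ}
  (hK : ∀ σ : K, (σ : A.Sections) ^ n = 1)
  [Finite K] [Y.IsSeparated] [IsSeparated (A.X.hom ≫ u)] [S.IsSeparated]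
  (hcov : ∀ x : A.left, ∃ O : (A.translationActionOver u K).StableAffineOpens, x ∈ O.1)
  [LocallyOfFiniteType (A.X.hom ≫ u)] [IsLocallyNoetherian Y]
  (hG : ∃ _ : GrpObj (A.quotientOver u K), IsMonHom (A.quotientMk u K hcov))
  (hsm : Smooth (A.quotientOver u K).hom) (hgc : GeometricallyConnected (A.quotientOver u K).hom)
  (D : A.DualPair) [IsAffine Y]
  (hfree : ∀ (Ω : Type u) [Field Ω] [IsAlgClosed Ω] (x : Spec (.of Ω) ⟶ A.left) (σ : K), σ ≠ 1 →
    x ≫ (A.translation (σ : A.Sections)).left ≠ x)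
  (K' : Subgroup D.hat.Sections) [Finite K'] [IsSeparated (D.hat.X.hom ≫ u)]
  (hcov' : ∀ x : D.hat.left, ∃ O : (D.hat.translationActionOver u K').StableAffineOpens, x ∈ O.1)
  {g : ℕ} (φ : LevelStructure g n D.hat)

/-- **`hStab` from `hChar`.**  For `S` reduced and locally Noetherian, `(n : κ(s)) ≠ 0` for all `s`, the unit hypothesis
`hD : 𝒫|_{A × e_Â} ≅ 𝒪` and a level-`n` structure `φ̂` on `Â`: if the character step `hChar` holds for
`𝒩₁ = (π × 1_Â)^*𝒫` on `(A/K) ×_S Â`, then for all `f : T → S` and `a a′ : T → Â` over `f`,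
`(1 × a)^*𝒩₁ ≅ (1 × a′)^*𝒩₁ ⟹ a ≫ ψ̂ = a′ ≫ ψ̂` (`ψ̂ : Â → Â/K′`) — the hypothesis `hStab` of ★
`eq_of_pullback_baseChangeToProd_poincareQuotRigid_iso` / `existsUnique_poincareQuotRigid_of_exists`.  Assembly: ★
`stabilizer_le_of_torsion_of_character` with `hTors :=` ★ `DualPair.comp_pow_id_left_eq_of_nonempty_pullback_iso`
(`ψ ≫ π = [n]_A`, ★ `quotientMk_comp_mulNDesc`). [cite: MumfordAV1970, §15 Thm. 1 (p. 143)]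
[cite: MilneAV2008, I §8 (pp. 36–37)] -/
theorem hStab_of_hChar [IsReduced S] [IsLocallyNoetherian S] (hn : ∀ s : S, (n : S.residueField s) ≠ 0)
    (hD : Nonempty ((Scheme.Modules.pullback (DualPair.unitHatSlice D)).obj D.P ≅ SheafOfModules.unit _))
    (hChar : ∀ (c : Fin g ⊕ Fin g → ZMod n) {U : Scheme.{u}} (w : U ⟶ S) [Nonempty U] (a a' : U ⟶ D.hat.X.left)
      (ha : a ≫ D.hat.X.hom = w) (ha' : a' ≫ D.hat.X.hom = w),
      a = a' ≫ (D.hat.translation (φ.section_ c)).left →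
      Nonempty ((Scheme.Modules.pullback ((A.quotientBy u K hcov hG hsm hgc).baseChangeToProd D.hat w a ha)).obj
          (A.poincarePullbackBundle u K hK hcov hG hsm hgc D hfree).L ≅
        (Scheme.Modules.pullback ((A.quotientBy u K hcov hG hsm hgc).baseChangeToProd D.hat w a' ha')).obj
          (A.poincarePullbackBundle u K hK hcov hG hsm hgc D hfree).L) →
      φ.section_ c ∈ K')
    {T : Scheme.{u}} (f : T ⟶ S) (a a' : T ⟶ D.hat.X.left) (ha : a ≫ D.hat.X.hom = f)
    (ha' : a' ≫ D.hat.X.hom = f)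
    (h : Nonempty ((Scheme.Modules.pullback ((A.quotientBy u K hcov hG hsm hgc).baseChangeToProd D.hat f a ha)).obj
        (A.poincarePullbackBundle u K hK hcov hG hsm hgc D hfree).L ≅
      (Scheme.Modules.pullback ((A.quotientBy u K hcov hG hsm hgc).baseChangeToProd D.hat f a' ha')).obj
        (A.poincarePullbackBundle u K hK hcov hG hsm hgc D hfree).L)) :
    a ≫ (D.hat.quotientMk u K' hcov').left = a' ≫ (D.hat.quotientMk u K' hcov').left := by
  haveI : IsCommMonObj D.hat.X := D.hat.isCommMonObj_of_isReduced_base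
  exact stabilizer_le_of_torsion_of_character (A.quotientBy u K hcov hG hsm hgc) D.hat u K' hcov'
    (A.poincarePullbackBundle u K hK hcov hG hsm hgc D hfree).L φ hn
    (fun f a a' ha ha' h => DualPair.comp_pow_id_left_eq_of_nonempty_pullback_iso
      (X := A.quotientBy u K hcov hG hsm hgc) D (A.mulNDesc u K hK hcov) f hD (A.quotientMk u K hcov) n
      (A.quotientMk_comp_mulNDesc u K hK hcov) a a' ha ha' h)
    hChar f a a' ha ha' h

end AbelianSchemeOver

end Literature.AlgebraicGeometry.AbelianSchemes

end
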